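import Summits.PneNP.PneNP.Theses.PositionalGames

/-!
# PneNP / PositionalGames — the glue `MpgTargetOfCruxes` (stmt-PneNP-1302)

Route `PneNP/PositionalGames`, support item stmt-PneNP-1302 (`MpgTargetOfCruxes`, rank 9):

  `MpgMonotoneSuperpoly → MpgNoMonotoneGap → MpgGeneralSuperpoly`.

Pure arithmetic on the three inlined statements. Fix `k`; let `c` be the exponent of the
no-gap hypothesis (T-cap) and apply the monotone lower bound (M2) at exponent `c * (k + 1)`.
For all large `n` some template `(o, v)` then satisfies
`n ^ (c * (k + 1)) < mSIZE F ≤ n ^ c * SIZE_B2(F) ^ c`; if `SIZE_B2(F) ≤ n ^ k` the right-hand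
side is at most `n ^ c * (n ^ k) ^ c = n ^ (c * (k + 1))`, a contradiction. Hence
`n ^ k < SIZE_B2(F)` for all large `n`, in particular frequently (`Filter.atTop` on `ℕ` is
non-trivial).
-/

set_option linter.dupNamespace false -- `Summit.PneNP.PneNP.…`: summit = sub-problem name (D-0017 single-conjunct layout)

namespace Summit.PneNP.PneNP.Theorems

open Filter
open Summit.PneNP.PneNP.Theses.PositionalGames (MpgMonotoneSuperpoly MpgNoMonotoneGap
  MpgGeneralSuperpoly MpgTargetOfCruxes)

/-- The arithmetic core of the glue: from `n ^ (c * (k + 1)) < a ≤ n ^ c * b ^ c` conclude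
`n ^ k < b` (otherwise `n ^ c * b ^ c ≤ n ^ c * (n ^ k) ^ c = n ^ (c * (k + 1))`). [folklore] -/
theorem mpgTargetOfCruxes_arith {n c k a b : ℕ} (h₁ : n ^ (c * (k + 1)) < a)
    (h₂ : a ≤ n ^ c * b ^ c) : n ^ k < b := by
  refine lt_of_not_ge fun hb => ?_
  have h₃ : n ^ c * b ^ c ≤ n ^ (c * (k + 1)) := by
    calc n ^ c * b ^ c ≤ n ^ c * (n ^ k) ^ c :=
          Nat.mul_le_mul_left _ (Nat.pow_le_pow_left hb c)
      _ = n ^ (c * (k + 1)) := by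
          rw [← pow_mul, ← pow_add]
          congr 1
          ring
  exact lt_irrefl _ (lt_of_lt_of_le h₁ (h₂.trans h₃))

/-- **Glue of route PositionalGames** (item stmt-PneNP-1302):
`MpgMonotoneSuperpoly → MpgNoMonotoneGap → MpgGeneralSuperpoly`. A superpolynomial MONOTONE
lower bound for threshold mean-payoff games (M2) together with the polynomial transfer
`mSIZE F ≤ n ^ c * SIZE_B2(F) ^ c` for every template (T-cap) gives a superpolynomial GENERAL
(`B2`) lower bound: M2 at exponent `c * (k + 1)` and `mpgTargetOfCruxes_arith` give
`n ^ k < SIZE_B2(F)` eventually, hence frequently. [folklore] -/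
theorem mpgTargetOfCruxes_proof :
    Summit.PneNP.PneNP.Theses.PositionalGames.MpgTargetOfCruxes := by
  unfold Summit.PneNP.PneNP.Theses.PositionalGames.MpgTargetOfCruxes
  intro hM hT k
  obtain ⟨c, hc⟩ := hT
  refine Filter.Eventually.frequently ?_
  filter_upwards [hM (c * (k + 1)), hc] with n hn hcn
  obtain ⟨o, v, hlt⟩ := hn
  exact ⟨o, v, mpgTargetOfCruxes_arith hlt (hcn o v)⟩

end Summit.PneNP.PneNP.Theorems
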